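import Literature.Analysis.FluidPDE.LocalTypeI
import Literature.Analysis.FluidPDE.CKNInterpolationEstimate
import HarnessLib

/-!
# Crux `TypeIliouvilleNoTypeII` (stmt-NavierStokesRegularity-0056), line `eternal_split`, stub
# `stub_eternalProfileOfTypeII` — VELOCITY-SIDE INHERITANCE, part 1: lower semicontinuity of the
# pressure-free Albritton–Barker quantities `A`, `C`, `E` under pointwise convergence

Helper file (theorems only) for the Type-II-exclusion estimate programme (D-0081 §B).  The Type-II
zoom package (`Theorems/TypeILiouvilleTypeIliouvilleNoTypeIITypeIIZoomPackage.lean`,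
`exists_typeIIZoomPackage`) exports a sequence of window zooms `w_j` converging at EVERY point of
`ℝ × ℝ³`, together with their spatial gradients, to a bounded eternal mild limit `v`, with
`‖w_j‖ ≤ 2` on growing windows.  To TRANSFER an a-priori estimate of Albritton–Barker / CKN type
to the limit one needs that the scaled quantities of `Literature/Analysis/FluidPDE/LocalTypeI.lean`
and `SuitableWeak.lean` do not jump up in such limits.  This file proves, for an ARBITRARY sequence
`w : ℕ → ℝ → ℝ³ → ℝ³`, a field `v` and ONE parabolic ball `Q = Q(z, r)`, `r > 0`, under

* eventual joint continuity of `w_j` on `Q` and an eventual uniform bound `‖w_j‖ ≤ N` on `Q`,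
* pointwise convergence `w_j → v` on `Q` (for `E`: of the gradients, eventually continuous on `Q`),

that an eventual bound `≤ I` on the zooms' quantity passes to the limit:

* `cknAEss_le_of_tendsto` — `A(Q) = esssup_t r⁻¹ ∫_{B} |·|²` (dominated convergence slice by slice,
  `ae_le_essSup`, `essSup_le_of_ae_le`);
* `cknC_le_of_tendsto` — `C(Q) = r⁻² ∫∫_Q |·|³` (dominated convergence on `Q`);
* `cknE_le_of_tendsto` — `E(Q) = r⁻¹ ∫∫_Q |∇·|²` (Fatou; no bound on the gradients is needed).

Pure measure theory over the tree's definitions; no Navier–Stokes input.  Part 2 (transport of the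
quantities along the window zooms and the transfer theorem for the package) is the companion file
`…EternalInheritanceTransfer.lean`.  WHAT THIS IS NOT: not NS; nothing here bears on regularity.
[folklore]
-/

noncomputable section

-- the summit and its single problem share the name (D-0017 nested layout)
set_option linter.dupNamespace false

open MeasureTheory Set Function Filter TopologicalSpace Metric
open scoped Topology NNReal ENNReal

namespace Summit.NavierStokesRegularity.NavierStokesRegularity.Theorems.TypeIliouvilleNoTypeII.EternalSplit

open Literature.Analysis Literature.Analysis.FluidPDE

variable {w : ℕ → ℝ → EuclideanSpace ℝ (Fin 3) → EuclideanSpace ℝ (Fin 3)}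
  {v : ℝ → EuclideanSpace ℝ (Fin 3) → EuclideanSpace ℝ (Fin 3)}
  {r N : ℝ} {z : ℝ × EuclideanSpace ℝ (Fin 3)} {I : ℝ≥0∞}

/-! ### Tools -/

/-- A backward parabolic cylinder has finite volume. [folklore] -/
theorem volume_parabolicCylinder_lt_top (r : ℝ) (z : ℝ × EuclideanSpace ℝ (Fin 3)) :
    volume (parabolicCylinder r z) < ⊤ :=
  ((Metric.isBounded_Ioo _ _).prod Metric.isBounded_ball).measure_lt_top

/-- In `ℝ≥0∞`: from `a⁻¹ * x ≤ I` with `a ≠ 0`, `a ≠ ⊤` we get `x ≤ a * I`. [folklore] -/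
theorem le_mul_of_inv_mul_le {a x I : ℝ≥0∞} (ha0 : a ≠ 0) (hatop : a ≠ ⊤) (h : a⁻¹ * x ≤ I) :
    x ≤ a * I := by
  calc x = a * (a⁻¹ * x) := by rw [← mul_assoc, ENNReal.mul_inv_cancel ha0 hatop, one_mul]
    _ ≤ a * I := by gcongr

/-- In `ℝ≥0∞`: from `x ≤ a * I` with `a ≠ 0`, `a ≠ ⊤` we get `a⁻¹ * x ≤ I`. [folklore] -/
theorem inv_mul_le_of_le_mul {a x I : ℝ≥0∞} (ha0 : a ≠ 0) (hatop : a ≠ ⊤) (h : x ≤ a * I) :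
    a⁻¹ * x ≤ I := by
  calc a⁻¹ * x ≤ a⁻¹ * (a * I) := by gcongr
    _ = I := by rw [← mul_assoc, ENNReal.inv_mul_cancel ha0 hatop, one_mul]

/-- The limit of a sequence eventually bounded by `B` is bounded by `B` (`ℝ≥0∞`). [folklore] -/
theorem le_of_tendsto_of_eventually_le {x : ℕ → ℝ≥0∞} {L B : ℝ≥0∞}
    (hx : Tendsto x atTop (𝓝 L)) (hB : ∀ᶠ j in atTop, x j ≤ B) : L ≤ B :=
  le_of_tendsto hx hB

/-- A pointwise limit of fields bounded by `N` on a set is bounded by `N` there. [folklore] -/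
theorem norm_le_of_tendsto {q : ℝ × EuclideanSpace ℝ (Fin 3)}
    (hbd : ∀ᶠ j in atTop, ‖w j q.1 q.2‖ ≤ N)
    (hlim : Tendsto (fun j => w j q.1 q.2) atTop (𝓝 (v q.1 q.2))) : ‖v q.1 q.2‖ ≤ N :=
  le_of_tendsto hlim.norm hbd

/-! ### `A`: the scaled slice energies -/

/-- Slice continuity: if `uncurry f` is continuous on `Q(z, r)` and `t ∈ (z.1 - r², z.1)`, then
`x ↦ f t x` is continuous on `B(z.2, r)`. [folklore] -/
theorem continuousOn_slice_of_continuousOn_parabolicCylinder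
    {f : ℝ → EuclideanSpace ℝ (Fin 3) → EuclideanSpace ℝ (Fin 3)}
    (hf : ContinuousOn (uncurry f) (parabolicCylinder r z)) {t : ℝ} (ht : t ∈ Ioo (z.1 - r ^ 2) z.1) :
    ContinuousOn (f t) (ball z.2 r) :=
  hf.comp (Continuous.prodMk_right t).continuousOn fun _ hx => ⟨ht, hx⟩

/-- **Slice energies converge** under pointwise convergence with a uniform bound: for
`t ∈ (z.1 - r², z.1)`, `∫_{B(z.2, r)} ‖w_{j+j₀}(t)‖² → ∫_{B(z.2, r)} ‖v(t)‖²` (dominated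
convergence; the shift `j₀` makes continuity and the bound hold for every index). [folklore] -/
theorem tendsto_lintegral_ball_sq {j₀ : ℕ}
    (hcont : ∀ j, j₀ ≤ j → ContinuousOn (uncurry (w j)) (parabolicCylinder r z))
    (hbd : ∀ j, j₀ ≤ j → ∀ q ∈ parabolicCylinder r z, ‖w j q.1 q.2‖ ≤ N)
    (hlim : ∀ q ∈ parabolicCylinder r z, Tendsto (fun j => w j q.1 q.2) atTop (𝓝 (v q.1 q.2)))
    {t : ℝ} (ht : t ∈ Ioo (z.1 - r ^ 2) z.1) :
    Tendsto (fun j => ∫⁻ x in ball z.2 r, ‖w (j + j₀) t x‖ₑ ^ 2) atTop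
      (𝓝 (∫⁻ x in ball z.2 r, ‖v t x‖ₑ ^ 2)) := by
  have hj : ∀ j : ℕ, j₀ ≤ j + j₀ := fun j => Nat.le_add_left j₀ j
  refine tendsto_lintegral_of_dominated_convergence' (fun _ => (ENNReal.ofReal N) ^ 2)
    (fun j => ?_) (fun j => ?_) ?_ ?_
  · exact ((continuousOn_slice_of_continuousOn_parabolicCylinder (hcont _ (hj j)) ht)
      |>.aestronglyMeasurable measurableSet_ball).aemeasurable.enorm.pow_const 2
  · refine (ae_restrict_iff' measurableSet_ball).2 (ae_of_all _ fun x hx => ?_)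
    have h := hbd _ (hj j) (t, x) ⟨ht, hx⟩
    have hN : 0 ≤ N := (norm_nonneg _).trans h
    calc ‖w (j + j₀) t x‖ₑ ^ 2 = ENNReal.ofReal ‖w (j + j₀) t x‖ ^ 2 := by
          rw [ofReal_norm]
      _ ≤ ENNReal.ofReal N ^ 2 := by gcongr
  · rw [lintegral_const]
    exact ENNReal.mul_ne_top (ENNReal.pow_ne_top ENNReal.ofReal_ne_top)
      (by rw [Measure.restrict_apply_univ]; exact measure_ball_lt_top.ne)
  · refine (ae_restrict_iff' measurableSet_ball).2 (ae_of_all _ fun x hx => ?_)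
    have h := (hlim (t, x) ⟨ht, hx⟩).comp (tendsto_add_atTop_nat j₀)
    exact ((ENNReal.continuous_pow 2).tendsto _).comp (h.enorm)

/-- **`A` does not jump up in pointwise limits.** If eventually `w_j` is jointly continuous on
`Q(z, r)` with `‖w_j‖ ≤ N` there, `w_j → v` pointwise on `Q(z, r)`, and eventually
`A(Q(z,r); w_j) ≤ I` (`cknAEss`, the essential supremum of the scaled slice energies), then
`A(Q(z,r); v) ≤ I`. [folklore] -/
theorem cknAEss_le_of_tendsto (hr : 0 < r)
    (hcont : ∀ᶠ j in atTop, ContinuousOn (uncurry (w j)) (parabolicCylinder r z))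
    (hbd : ∀ᶠ j in atTop, ∀ q ∈ parabolicCylinder r z, ‖w j q.1 q.2‖ ≤ N)
    (hlim : ∀ q ∈ parabolicCylinder r z, Tendsto (fun j => w j q.1 q.2) atTop (𝓝 (v q.1 q.2)))
    (hA : ∀ᶠ j in atTop, cknAEss r z (w j) ≤ I) : cknAEss r z v ≤ I := by
  obtain ⟨j₀, hj₀⟩ := eventually_atTop.1 ((hcont.and hbd).and hA)
  have hr0 : ENNReal.ofReal r ≠ 0 := (ENNReal.ofReal_pos.2 hr).ne'
  have hrt : ENNReal.ofReal r ≠ ⊤ := ENNReal.ofReal_ne_top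
  -- for a.e. `t`: every shifted zoom has slice quantity `≤ I`
  have hae : ∀ᵐ t ∂(volume.restrict (Ioo (z.1 - r ^ 2) z.1)), ∀ j : ℕ,
      (ENNReal.ofReal r)⁻¹ * ∫⁻ x in ball z.2 r, ‖w (j + j₀) t x‖ₑ ^ 2 ≤ I := by
    rw [ae_all_iff]
    intro j
    have hle : cknAEss r z (w (j + j₀)) ≤ I := (hj₀ _ (Nat.le_add_left j₀ j)).2
    filter_upwards [ENNReal.ae_le_essSup (μ := volume.restrict (Ioo (z.1 - r ^ 2) z.1))
      (fun t => (ENNReal.ofReal r)⁻¹ * ∫⁻ x in ball z.2 r, ‖w (j + j₀) t x‖ₑ ^ 2)] with t ht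
    exact ht.trans hle
  refine essSup_le_of_ae_le I ?_
  filter_upwards [hae, ae_restrict_mem measurableSet_Ioo] with t ht htI
  have hT := tendsto_lintegral_ball_sq (fun j hj => (hj₀ j hj).1.1) (fun j hj => (hj₀ j hj).1.2)
    hlim htI
  have hlimle : ∫⁻ x in ball z.2 r, ‖v t x‖ₑ ^ 2 ≤ ENNReal.ofReal r * I :=
    le_of_tendsto_of_eventually_le hT (Eventually.of_forall fun j =>
      le_mul_of_inv_mul_le hr0 hrt (ht j))
  exact inv_mul_le_of_le_mul hr0 hrt hlimle

/-! ### `C`: the scaled cubes -/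

/-- **`C` does not jump up in pointwise limits** (in fact it converges): under the same
hypotheses, an eventual bound `C(Q(z,r); w_j) ≤ I` (`cknC`) gives `C(Q(z,r); v) ≤ I`. [folklore] -/
theorem cknC_le_of_tendsto (hr : 0 < r)
    (hcont : ∀ᶠ j in atTop, ContinuousOn (uncurry (w j)) (parabolicCylinder r z))
    (hbd : ∀ᶠ j in atTop, ∀ q ∈ parabolicCylinder r z, ‖w j q.1 q.2‖ ≤ N)
    (hlim : ∀ q ∈ parabolicCylinder r z, Tendsto (fun j => w j q.1 q.2) atTop (𝓝 (v q.1 q.2)))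
    (hC : ∀ᶠ j in atTop, cknC r z (w j) ≤ I) : cknC r z v ≤ I := by
  obtain ⟨j₀, hj₀⟩ := eventually_atTop.1 ((hcont.and hbd).and hC)
  have hj : ∀ j : ℕ, j₀ ≤ j + j₀ := fun j => Nat.le_add_left j₀ j
  have hQm : MeasurableSet (parabolicCylinder r z) := (isOpen_parabolicCylinder r z).measurableSet
  have hr0 : ENNReal.ofReal r ^ 2 ≠ 0 := pow_ne_zero _ (ENNReal.ofReal_pos.2 hr).ne'
  have hrt : ENNReal.ofReal r ^ 2 ≠ ⊤ := ENNReal.pow_ne_top ENNReal.ofReal_ne_top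
  -- dominated convergence on `Q`
  have hT : Tendsto (fun j => ∫⁻ q in parabolicCylinder r z, ‖w (j + j₀) q.1 q.2‖ₑ ^ (3 : ℕ)) atTop
      (𝓝 (∫⁻ q in parabolicCylinder r z, ‖v q.1 q.2‖ₑ ^ (3 : ℕ))) := by
    refine tendsto_lintegral_of_dominated_convergence' (fun _ => (ENNReal.ofReal N) ^ 3)
      (fun j => ?_) (fun j => ?_) ?_ ?_
    · exact ((hj₀ _ (hj j)).1.1.aestronglyMeasurable hQm).aemeasurable.enorm.pow_const 3
    · refine (ae_restrict_iff' hQm).2 (ae_of_all _ fun q hq => ?_)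
      have h := (hj₀ _ (hj j)).1.2 q hq
      have hN : 0 ≤ N := (norm_nonneg _).trans h
      calc ‖w (j + j₀) q.1 q.2‖ₑ ^ 3 = ENNReal.ofReal ‖w (j + j₀) q.1 q.2‖ ^ 3 := by
            rw [ofReal_norm]
        _ ≤ ENNReal.ofReal N ^ 3 := by gcongr
    · rw [lintegral_const]
      exact ENNReal.mul_ne_top (ENNReal.pow_ne_top ENNReal.ofReal_ne_top)
        ((measure_mono (μ := volume.restrict (parabolicCylinder r z)) (subset_univ _)).trans_lt
          (by rw [Measure.restrict_apply_univ]; exact volume_parabolicCylinder_lt_top r z)).ne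
    · refine (ae_restrict_iff' hQm).2 (ae_of_all _ fun q hq => ?_)
      have h := (hlim q hq).comp (tendsto_add_atTop_nat j₀)
      exact ((ENNReal.continuous_pow 3).tendsto _).comp h.enorm
  have hlimle : ∫⁻ q in parabolicCylinder r z, ‖v q.1 q.2‖ₑ ^ (3 : ℕ) ≤ ENNReal.ofReal r ^ 2 * I :=
    le_of_tendsto_of_eventually_le hT (Eventually.of_forall fun j =>
      le_mul_of_inv_mul_le hr0 hrt (hj₀ _ (hj j)).2)
  exact inv_mul_le_of_le_mul hr0 hrt hlimle

/-! ### `E`: the scaled dissipation (Fatou) -/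

/-- **`E` does not jump up in pointwise limits of the gradients** (Fatou): if eventually the
gradient fields `q ↦ ∇w_j(q)` are continuous on `Q(z, r)`, `∇w_j → ∇v` pointwise on `Q(z, r)`,
and eventually `E(Q(z,r); ∇w_j) ≤ I` (`cknE`), then `E(Q(z,r); ∇v) ≤ I`.  No bound on the
gradients is required. [folklore] -/
theorem cknE_le_of_tendsto (hr : 0 < r)
    (hgcont : ∀ᶠ j in atTop,
      ContinuousOn (fun q : ℝ × EuclideanSpace ℝ (Fin 3) => fderiv ℝ (w j q.1) q.2)
        (parabolicCylinder r z))
    (hglim : ∀ q ∈ parabolicCylinder r z,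
      Tendsto (fun j => fderiv ℝ (w j q.1) q.2) atTop (𝓝 (fderiv ℝ (v q.1) q.2)))
    (hE : ∀ᶠ j in atTop, cknE r z (fun t x => fderiv ℝ (w j t) x) ≤ I) :
    cknE r z (fun t x => fderiv ℝ (v t) x) ≤ I := by
  obtain ⟨j₀, hj₀⟩ := eventually_atTop.1 (hgcont.and hE)
  have hj : ∀ j : ℕ, j₀ ≤ j + j₀ := fun j => Nat.le_add_left j₀ j
  have hQm : MeasurableSet (parabolicCylinder r z) := (isOpen_parabolicCylinder r z).measurableSet
  have hr0 : ENNReal.ofReal r ≠ 0 := (ENNReal.ofReal_pos.2 hr).ne'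
  have hrt : ENNReal.ofReal r ≠ ⊤ := ENNReal.ofReal_ne_top
  set F : ℕ → ℝ × EuclideanSpace ℝ (Fin 3) → ℝ≥0∞ := fun j q =>
    ENNReal.ofReal (frobeniusNormSq (fderiv ℝ (w (j + j₀) q.1) q.2)) with hF
  have hFm : ∀ j, AEMeasurable (F j) (volume.restrict (parabolicCylinder r z)) := fun j =>
    (ENNReal.continuous_ofReal.comp_continuousOn
      (continuous_frobeniusNormSq'.comp_continuousOn (hj₀ _ (hj j)).1)).aemeasurable hQm
  -- the integrand of the limit is the pointwise limit, hence the liminf, of the `F j`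
  have hptw : ∀ q ∈ parabolicCylinder r z,
      liminf (fun j => F j q) atTop = ENNReal.ofReal (frobeniusNormSq (fderiv ℝ (v q.1) q.2)) := by
    intro q hq
    have h := (hglim q hq).comp (tendsto_add_atTop_nat j₀)
    exact ((ENNReal.continuous_ofReal.tendsto _).comp
      ((continuous_frobeniusNormSq'.tendsto _).comp h)).liminf_eq
  have hcongr : ∫⁻ q in parabolicCylinder r z, ENNReal.ofReal (frobeniusNormSq (fderiv ℝ (v q.1) q.2)) =
      ∫⁻ q in parabolicCylinder r z, liminf (fun j => F j q) atTop :=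
    setLIntegral_congr_fun hQm fun q hq => (hptw q hq).symm
  -- Fatou
  have hfatou : ∫⁻ q in parabolicCylinder r z, liminf (fun j => F j q) atTop ≤
      liminf (fun j => ∫⁻ q in parabolicCylinder r z, F j q) atTop :=
    lintegral_liminf_le' hFm
  -- the zooms' integrals are eventually `≤ r I`
  have hbdd : liminf (fun j => ∫⁻ q in parabolicCylinder r z, F j q) atTop ≤ ENNReal.ofReal r * I := by
    refine liminf_le_of_frequently_le' (Frequently.of_forall fun j => ?_)
    exact le_mul_of_inv_mul_le hr0 hrt (hj₀ _ (hj j)).2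
  unfold cknE
  rw [hcongr]
  exact inv_mul_le_of_le_mul hr0 hrt (hfatou.trans hbdd)

end Summit.NavierStokesRegularity.NavierStokesRegularity.Theorems.TypeIliouvilleNoTypeII.EternalSplit

end
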